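import Literature.MathematicalPhysics.QuantumManyBody.LeeHuangYangIntegral
import HarnessLib

/-!
# The Lee–Huang–Yang lattice sum is bounded by the Lee–Huang–Yang integral:
# `h³ ∑_{p ∈ hℤ³∖0, p ∈ S} F_μ(p) ≤ ∫_{ℝ³} F_μ + O(μ^{5/2}(h/√μ)^{1/2})` (Riemann-sum upper bound)

Topic `Literature/MathematicalPhysics/QuantumManyBody`, proofs-only companion of
`LeeHuangYangIntegral.lean` (`integral_bogoliubov`:
`∫_{ℝ³} F_μ = (32√2π/15) μ^{5/2}`, `lhy_correction_integral`), written for the provefact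
`Literature.MathematicalPhysics.QuantumManyBody.BoseGas.BastiCenatiempoSchlein2021_upperBound`
(= `BCS2021_lhyUpperBound_dirichlet`, [BastiCenatiempoSchlein2021, Thm. 1.1]), whose remaining content
after `DiluteBoseGasUpperBoundGrandCanonical.BastiCenatiempoSchlein2021_upperBound_of_grandCanonicalLHYBlocks`
is the periodic trial state of [BastiCenatiempoSchlein2021, Prop. 1.3]. The LAST step of the energy
computation for that trial state, [BastiCenatiempoSchlein2021, §3, (3.20) ⇒ (3.21), p. 13 of
arXiv:2101.06222], reads: "`E_N^Ψ ≤ 4π𝔞N^{1+κ} + (N^κ/2) ∑_{v ∈ 2πN^{-κ/2}ℤ³} [√(v⁴+16π𝔞v²) - v² - 8π𝔞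
+ (8π𝔞)²/(2v²)] + …`. Recognizing that (3.20) defines a Riemann sum and explicitly computing
`½(2π)⁻³∫ […] = 4π𝔞·(128/(15√π))𝔞^{3/2}` we conclude … To compare the Riemann sum in (3.20) with the
integral, we first removed contributions arising from `|v| ≤ N^{-ε}` using that `|F(v)| ≤ C/v²`, for
small `v` …. For `|v| > N^{-ε}`, we use that `|∇F(v)| ≤ C|v|⁻³(1+v²)⁻¹` to compare the value of `F(q)`
with `F(v)`, for all `q` in the cube of size `2πN^{-κ/2}` centered at `v`."

This file PROVES that comparison, for the Bogoliubov integrand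
`F_μ(p) = √(|p|⁴ + 2μ|p|²) - |p|² - μ + μ²/(2|p|²)` (`μ > 0`; `μ = 8π𝔞` resp. `8πρ𝔞`) on the
lattice `hℤ³` (`latticeVec h n`, `h > 0`), in the ONE-SIDED form an upper bound needs and with explicit
constants: for every finite `S ⊆ ℤ³ ∖ {0}`,

* `cube_mul_latticeSum_bogoliubov_le` —
  `h³ ∑_{n ∈ S} F_μ(h·n) ≤ ∫_{ℝ³} F_μ + 279936 μ²√μ √(h/√μ) + 512 μ²h`;
* `cube_mul_latticeSum_bogoliubov_le'` — the same with `∫ F_μ = (32√2π/15)μ^{5/2}` inserted: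
  `h³ ∑_{n ∈ S} F_μ(h·n) ≤ (32√2π/15) μ^{5/2} + 3·10⁵ μ^{5/2} (√(h/√μ) + h/√μ)`;
* `half_latticeSum_bogoliubov_le_lhy` — the physical normalisation on the torus of side `L`
  (`h = 2π/L`, `μ = 8πρ𝔞`): `½ ∑_{n ∈ S} F_{8πρ𝔞}(2πn/L) ≤ L³ · [4πρ²𝔞 · lhyConstant · √(ρ𝔞³) +
  ½(2π)⁻³ · 3·10⁵ μ^{5/2}(√(h/√μ) + h/√μ)]`, i.e. one half of the Bogoliubov sum over ANY finite set
  of non-zero torus momenta is at most the Lee–Huang–Yang energy `4πρ²𝔞(128/(15√π))√(ρ𝔞³)L³` plus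
  `O(L³(ρ𝔞)^{5/2}(ρ𝔞L²)^{-1/4})`.

Since `F_μ ≥ 0` (`bogoliubov_nonneg`), restricting the sum to a finite set (the paper's `P_L`) costs
nothing in this direction, no summability is needed, and the bound holds for all `h > 0`. The error
`(h/√μ)^{1/2}` (any positive power would do for [BastiCenatiempoSchlein2021], where `h/√μ = N^{-κ/2}·C`)
comes from the majorant `|φ_μ'| ≤ 8μ³/(r³(r²+2μ)) ≤ 64√2μ³/(μ^{3/4}(r/2)… )`, chosen to avoid logarithms.

## Contents (all proved; no definitions, no named facts)

* Scalar algebra of the radial profile `φ_μ(r) = √(r⁴+2μr²) - r² - μ + μ²/(2r²)`: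
  `bogoliubov_eq_rationalised` (`φ_μ = μ²(R - r² + μ)/(2r²(R + r² + μ))`, `R = √(r⁴+2μr²)`),
  `bogoliubov_nonneg`, `bogoliubov_le_sq_div` (`φ_μ ≤ μ²/r²`), `bogoliubov_le_cube_div`
  (`φ_μ ≤ μ³/(2r⁴)`), `hasDerivAt_bogoliubov`, `abs_deriv_bogoliubov_le`
  (`|φ_μ'| ≤ 8μ³/(r³(r²+2μ))`, via `φ_μ' = -2μ³(s²+3sr+4r²)/(r³s(s+r)³)`, `s = √(r²+2μ)`),
  `abs_bogoliubov_sub_le` (mean-value bound on `[ρ₀, ∞)`).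
* Lattice geometry: cubes `h·n + [0,h)³` (`measurableSet_cube`, `volume_cube`, `disjoint_cube`,
  `norm_sub_latticeVec_le`), `le_norm_latticeVec_of_ne_zero` (`‖h·n‖ ≥ h` for `n ≠ 0`),
  `card_filter_norm_latticeVec_lt_le` (`#{n : ‖h·n‖ < ϱ} ≤ (2ϱ/h+1)³`), and the dyadic shell sum
  `sum_shells_le` (`∑_{‖h·n‖ ≥ c₀h} ‖h·n‖^{-7/2} ≤ 1458/(h³√(c₀h))`, shells `c₀h4ᵏ ≤ ‖h·n‖ < c₀h4ᵏ⁺¹`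
  indexed by `Nat.log 4`).
* The cube comparison `cube_mul_bogoliubov_latticeVec_le`
  (`h³F_μ(h·n) ≤ ∫_{cube} F_μ + h³·64√6·hμ³/(μ^{3/4}‖h·n‖^{7/2})` for `‖h·n‖ ≥ 2√3h`) and the assembly.

Related tree file (independent, complementary): `LHYIntegrandBounds.lean` (bounds on the `μ = 1`
profile for the LOWER Riemann bound of [FournaisEtAl2024, Lemma 8.1] on the Neumann box).

## References

* [BastiCenatiempoSchlein2021] G. Basti, S. Cenatiempo, B. Schlein, *A new second-order upper bound
  for the ground state energy of dilute Bose gases*, Forum Math. Sigma 9 (2021) e74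
  (arXiv:2101.06222): §3, (3.20)–(3.21) and the closing paragraph of §3 (p. 13); (1.2) for the
  constant `128/(15√π)`.
* [LSSY2005] E. H. Lieb, R. Seiringer, J. P. Solovej, J. Yngvason, *The Mathematics of the Bose Gas
  and its Condensation* (2005), App. A (A.3): the torus momenta `(2π/L)ℤ³`.
-/

noncomputable section

open MeasureTheory Set Filter Topology Metric
open scoped ENNReal NNReal

namespace Literature.MathematicalPhysics.QuantumManyBody.BoseGas

/-! ### The Bogoliubov integrand as a function of `r = |p|`: rationalised form and bounds -/

/-- `√(r⁴ + 2μr²) = r √(r² + 2μ)` for `r ≥ 0`. [folklore] -/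
theorem sqrt_pow_four_add_two_mul_sq (μ : ℝ) {r : ℝ} (hr : 0 ≤ r) :
    Real.sqrt (r ^ 4 + 2 * μ * r ^ 2) = r * Real.sqrt (r ^ 2 + 2 * μ) := by
  rw [show r ^ 4 + 2 * μ * r ^ 2 = r ^ 2 * (r ^ 2 + 2 * μ) by ring, Real.sqrt_mul (sq_nonneg r),
    Real.sqrt_sq hr]

/-- **Rationalised form of the Bogoliubov integrand.** For `r > 0`, `μ ≥ 0`, with `R = √(r⁴+2μr²)`:
`R - r² - μ + μ²/(2r²) = μ² (R - r² + μ) / (2r²(R + r² + μ))`. [folklore] -/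
theorem bogoliubov_eq_rationalised {μ r : ℝ} (hμ : 0 ≤ μ) (hr : 0 < r) :
    Real.sqrt (r ^ 4 + 2 * μ * r ^ 2) - r ^ 2 - μ + μ ^ 2 / (2 * r ^ 2) =
      μ ^ 2 * (Real.sqrt (r ^ 4 + 2 * μ * r ^ 2) - r ^ 2 + μ) /
        (2 * r ^ 2 * (Real.sqrt (r ^ 4 + 2 * μ * r ^ 2) + r ^ 2 + μ)) := by
  set R := Real.sqrt (r ^ 4 + 2 * μ * r ^ 2) with hR
  have hR0 : 0 ≤ R := Real.sqrt_nonneg _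
  have hR2 : R ^ 2 = r ^ 4 + 2 * μ * r ^ 2 := Real.sq_sqrt (by positivity)
  have hD : 0 < R + r ^ 2 + μ := by positivity
  have h1 : R - r ^ 2 - μ = -μ ^ 2 / (R + r ^ 2 + μ) := by
    rw [eq_div_iff hD.ne']
    linear_combination hR2
  rw [h1]
  field_simp
  ring

/-- `r² ≤ √(r⁴ + 2μr²)` for `μ ≥ 0`. [folklore] -/
theorem sq_le_sqrt_pow_four_add {μ : ℝ} (hμ : 0 ≤ μ) (r : ℝ) :
    r ^ 2 ≤ Real.sqrt (r ^ 4 + 2 * μ * r ^ 2) := by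
  have h := Real.sqrt_le_sqrt (x := (r ^ 2) ^ 2) (y := r ^ 4 + 2 * μ * r ^ 2)
    (by nlinarith [sq_nonneg r, mul_nonneg hμ (sq_nonneg r)])
  rwa [Real.sqrt_sq (sq_nonneg r)] at h

/-- `√(r⁴ + 2μr²) ≤ r² + μ` for `μ ≥ 0`. [folklore] -/
theorem sqrt_pow_four_add_le {μ : ℝ} (hμ : 0 ≤ μ) (r : ℝ) :
    Real.sqrt (r ^ 4 + 2 * μ * r ^ 2) ≤ r ^ 2 + μ := by
  rw [Real.sqrt_le_left (by positivity)]
  nlinarith [sq_nonneg μ]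

/-- **Positivity of the Bogoliubov integrand**: `√(r⁴+2μr²) - r² - μ + μ²/(2r²) ≥ 0` for `r > 0`,
`μ ≥ 0`. [folklore] -/
theorem bogoliubov_nonneg {μ r : ℝ} (hμ : 0 ≤ μ) (hr : 0 < r) :
    0 ≤ Real.sqrt (r ^ 4 + 2 * μ * r ^ 2) - r ^ 2 - μ + μ ^ 2 / (2 * r ^ 2) := by
  rw [bogoliubov_eq_rationalised hμ hr]
  have h1 := sq_le_sqrt_pow_four_add hμ r
  have hR0 : 0 ≤ Real.sqrt (r ^ 4 + 2 * μ * r ^ 2) := Real.sqrt_nonneg _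
  apply div_nonneg
  · exact mul_nonneg (sq_nonneg μ) (by linarith)
  · positivity

/-- **Small-`r` bound**: `√(r⁴+2μr²) - r² - μ + μ²/(2r²) ≤ μ²/r²` (`r > 0`, `μ ≥ 0`). [folklore] -/
theorem bogoliubov_le_sq_div {μ r : ℝ} (hμ : 0 ≤ μ) (hr : 0 < r) :
    Real.sqrt (r ^ 4 + 2 * μ * r ^ 2) - r ^ 2 - μ + μ ^ 2 / (2 * r ^ 2) ≤ μ ^ 2 / r ^ 2 := by
  rw [bogoliubov_eq_rationalised hμ hr]
  set R := Real.sqrt (r ^ 4 + 2 * μ * r ^ 2) with hR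
  have h1 : r ^ 2 ≤ R := sq_le_sqrt_pow_four_add hμ r
  have h2 : R ≤ r ^ 2 + μ := sqrt_pow_four_add_le hμ r
  have hr2 : 0 < r ^ 2 := by positivity
  have hD : 0 < 2 * r ^ 2 * (R + r ^ 2 + μ) := by positivity
  rw [div_le_div_iff₀ hD hr2]
  have : μ ^ 2 * (R - r ^ 2 + μ) * r ^ 2 ≤ μ ^ 2 * (2 * μ) * r ^ 2 := by
    gcongr
    linarith
  nlinarith [sq_nonneg μ, mul_nonneg (sq_nonneg μ) hr2.le]

/-- **Large-`r` bound**: `√(r⁴+2μr²) - r² - μ + μ²/(2r²) ≤ μ³/(2r⁴)` (`r > 0`, `μ ≥ 0`). [folklore] -/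
theorem bogoliubov_le_cube_div {μ r : ℝ} (hμ : 0 ≤ μ) (hr : 0 < r) :
    Real.sqrt (r ^ 4 + 2 * μ * r ^ 2) - r ^ 2 - μ + μ ^ 2 / (2 * r ^ 2) ≤ μ ^ 3 / (2 * r ^ 4) := by
  rw [bogoliubov_eq_rationalised hμ hr]
  set R := Real.sqrt (r ^ 4 + 2 * μ * r ^ 2) with hR
  have h1 : r ^ 2 ≤ R := sq_le_sqrt_pow_four_add hμ r
  have hR2 : R ^ 2 = r ^ 4 + 2 * μ * r ^ 2 := Real.sq_sqrt (by positivity)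
  have hr2 : 0 < r ^ 2 := by positivity
  have hD : 0 < 2 * r ^ 2 * (R + r ^ 2 + μ) := by positivity
  rw [div_le_div_iff₀ hD (by positivity)]
  have h2 : R ≤ r ^ 2 + μ := sqrt_pow_four_add_le hμ r
  have hr4 : 0 ≤ r ^ 4 := by positivity
  have hkey : (R - r ^ 2 + μ) * (2 * r ^ 4) ≤ μ * (2 * r ^ 2 * (R + r ^ 2 + μ)) := by
    calc (R - r ^ 2 + μ) * (2 * r ^ 4) ≤ (2 * μ) * (2 * r ^ 4) := by
          apply mul_le_mul_of_nonneg_right _ (by positivity); linarith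
      _ = μ * (2 * r ^ 2 * (r ^ 2 + r ^ 2 + 0)) := by ring
      _ ≤ μ * (2 * r ^ 2 * (R + r ^ 2 + μ)) := by gcongr
  calc μ ^ 2 * (R - r ^ 2 + μ) * (2 * r ^ 4) = μ ^ 2 * ((R - r ^ 2 + μ) * (2 * r ^ 4)) := by ring
    _ ≤ μ ^ 2 * (μ * (2 * r ^ 2 * (R + r ^ 2 + μ))) := by gcongr
    _ = μ ^ 3 * (2 * r ^ 2 * (R + r ^ 2 + μ)) := by ring

/-! ### The derivative of the radial profile and its bound `|φ'(r)| ≤ 8μ³/(r³(r²+2μ))` -/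

/-- The derivative of `φ(r) = √(r⁴+2μr²) - r² - μ + μ²/(2r²)` at `r > 0` (`μ ≥ 0`):
`φ'(r) = (2r³+2μr)/√(r⁴+2μr²) - 2r - μ²/r³`. [folklore] -/
theorem hasDerivAt_bogoliubov {μ r : ℝ} (hμ : 0 ≤ μ) (hr : 0 < r) :
    HasDerivAt (fun x => Real.sqrt (x ^ 4 + 2 * μ * x ^ 2) - x ^ 2 - μ + μ ^ 2 / (2 * x ^ 2))
      ((2 * r ^ 3 + 2 * μ * r) / Real.sqrt (r ^ 4 + 2 * μ * r ^ 2) - 2 * r - μ ^ 2 / r ^ 3) r := by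
  have hsq : HasDerivAt (fun x : ℝ => x ^ 2) (2 * r) r := by simpa using hasDerivAt_pow 2 r
  have h4 : HasDerivAt (fun x : ℝ => x ^ 4) (4 * r ^ 3) r := by simpa using hasDerivAt_pow 4 r
  have h2 : HasDerivAt (fun x : ℝ => 2 * μ * x ^ 2) (2 * μ * (2 * r)) r := hsq.const_mul (2 * μ)
  have hu : HasDerivAt (fun x : ℝ => x ^ 4 + 2 * μ * x ^ 2) (4 * r ^ 3 + 2 * μ * (2 * r)) r :=
    h4.add h2
  have hpos : 0 < r ^ 4 + 2 * μ * r ^ 2 := by positivity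
  have hRpos : 0 < Real.sqrt (r ^ 4 + 2 * μ * r ^ 2) := Real.sqrt_pos.2 hpos
  have hsqrt : HasDerivAt (fun x : ℝ => Real.sqrt (x ^ 4 + 2 * μ * x ^ 2))
      ((4 * r ^ 3 + 2 * μ * (2 * r)) / (2 * Real.sqrt (r ^ 4 + 2 * μ * r ^ 2))) r :=
    hu.sqrt hpos.ne'
  have hinv : HasDerivAt (fun x : ℝ => μ ^ 2 / (2 * x ^ 2)) (-(μ ^ 2) / r ^ 3) r := by
    have hd : HasDerivAt (fun x : ℝ => 2 * x ^ 2) (2 * (2 * r)) r := hsq.const_mul 2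
    have h : HasDerivAt (fun x : ℝ => μ ^ 2 / (2 * x ^ 2))
        ((0 * (2 * r ^ 2) - μ ^ 2 * (2 * (2 * r))) / (2 * r ^ 2) ^ 2) r :=
      (hasDerivAt_const r (μ ^ 2)).div hd (by positivity : (2 * r ^ 2 : ℝ) ≠ 0)
    refine h.congr_deriv ?_
    field_simp
    ring
  have hall : HasDerivAt (fun x => Real.sqrt (x ^ 4 + 2 * μ * x ^ 2) - x ^ 2 - μ + μ ^ 2 / (2 * x ^ 2))
      ((4 * r ^ 3 + 2 * μ * (2 * r)) / (2 * Real.sqrt (r ^ 4 + 2 * μ * r ^ 2)) - 2 * r - 0 +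
        -(μ ^ 2) / r ^ 3) r :=
    ((hsqrt.sub hsq).sub (hasDerivAt_const r μ)).add hinv
  refine hall.congr_deriv ?_
  field_simp
  ring

/-- **The derivative bound.** For `r > 0`, `μ ≥ 0`:
`|(2r³+2μr)/√(r⁴+2μr²) - 2r - μ²/r³| ≤ 8μ³/(r³(r²+2μ))`. With `s = √(r²+2μ)` the derivative is
exactly `-2μ³(s²+3sr+4r²)/(r³s(s+r)³) ≤ 0`, and `s²+3sr+4r² ≤ 4(s+r)²`, `s ≤ s + r`.
[cite: BastiCenatiempoSchlein2021, §3, last paragraph (`|∇F(v)| ≤ C|v|⁻³(1+v²)⁻¹`)] -/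
theorem abs_deriv_bogoliubov_le {μ r : ℝ} (hμ : 0 ≤ μ) (hr : 0 < r) :
    |(2 * r ^ 3 + 2 * μ * r) / Real.sqrt (r ^ 4 + 2 * μ * r ^ 2) - 2 * r - μ ^ 2 / r ^ 3| ≤
      8 * μ ^ 3 / (r ^ 3 * (r ^ 2 + 2 * μ)) := by
  set s := Real.sqrt (r ^ 2 + 2 * μ) with hs
  have hs2 : s ^ 2 = r ^ 2 + 2 * μ := Real.sq_sqrt (by positivity)
  have hμ' : μ = (s ^ 2 - r ^ 2) / 2 := by linarith
  have hs0 : 0 < s := Real.sqrt_pos.2 (by positivity)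
  have hrs : r ≤ s := by
    rw [hs]
    calc r = Real.sqrt (r ^ 2) := (Real.sqrt_sq hr.le).symm
      _ ≤ Real.sqrt (r ^ 2 + 2 * μ) := Real.sqrt_le_sqrt (by linarith)
  have hsr : 0 < s + r := by linarith
  have hR : Real.sqrt (r ^ 4 + 2 * μ * r ^ 2) = r * s := sqrt_pow_four_add_two_mul_sq μ hr.le
  have hr3 : 0 < r ^ 3 := by positivity
  -- the derivative in terms of `s`
  have hD : (2 * r ^ 3 + 2 * μ * r) / Real.sqrt (r ^ 4 + 2 * μ * r ^ 2) - 2 * r - μ ^ 2 / r ^ 3 =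
      -(μ ^ 2 / r ^ 3 - 4 * μ ^ 2 / ((s + r) ^ 2 * s)) := by
    rw [hR]
    have h1 : (2 * r ^ 3 + 2 * μ * r) / (r * s) - 2 * r = (s - r) ^ 2 / s := by
      rw [div_sub' (by positivity), div_eq_div_iff (by positivity) hs0.ne', hμ']
      ring
    have h2 : (s - r) ^ 2 = 4 * μ ^ 2 / (s + r) ^ 2 := by
      rw [eq_div_iff (by positivity), hμ']
      ring
    rw [h1, h2, div_div]
    ring
  -- the exact form `2μ³(s²+3sr+4r²)/(r³s(s+r)³)`
  have hE : μ ^ 2 / r ^ 3 - 4 * μ ^ 2 / ((s + r) ^ 2 * s) =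
      2 * μ ^ 3 * (s ^ 2 + 3 * s * r + 4 * r ^ 2) / (r ^ 3 * s * (s + r) ^ 3) := by
    rw [div_sub_div _ _ hr3.ne' (by positivity), div_eq_div_iff (by positivity) (by positivity), hμ']
    ring
  have hEnonneg : 0 ≤ 2 * μ ^ 3 * (s ^ 2 + 3 * s * r + 4 * r ^ 2) / (r ^ 3 * s * (s + r) ^ 3) := by
    positivity
  rw [hD, abs_neg, hE, abs_of_nonneg hEnonneg, div_le_div_iff₀ (by positivity) (by positivity), ← hs2]
  have h1 : s ^ 2 + 3 * s * r + 4 * r ^ 2 ≤ 4 * (s + r) ^ 2 := by nlinarith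
  have h2 : (s ^ 2 + 3 * s * r + 4 * r ^ 2) * s ≤ 4 * (s + r) ^ 2 * (s + r) :=
    mul_le_mul h1 (by linarith) hs0.le (by positivity)
  have h3 : 0 ≤ 2 * μ ^ 3 * (r ^ 3 * s) := by positivity
  calc 2 * μ ^ 3 * (s ^ 2 + 3 * s * r + 4 * r ^ 2) * (r ^ 3 * s ^ 2)
      = 2 * μ ^ 3 * (r ^ 3 * s) * ((s ^ 2 + 3 * s * r + 4 * r ^ 2) * s) := by ring
    _ ≤ 2 * μ ^ 3 * (r ^ 3 * s) * (4 * (s + r) ^ 2 * (s + r)) := by gcongr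
    _ = 8 * μ ^ 3 * (r ^ 3 * s * (s + r) ^ 3) := by ring

/-- The majorant `8μ³/(r³(r²+2μ))` is antitone in `r > 0`. [folklore] -/
theorem derivBound_antitone {μ a b : ℝ} (hμ : 0 ≤ μ) (ha : 0 < a) (hab : a ≤ b) :
    8 * μ ^ 3 / (b ^ 3 * (b ^ 2 + 2 * μ)) ≤ 8 * μ ^ 3 / (a ^ 3 * (a ^ 2 + 2 * μ)) := by
  apply div_le_div_of_nonneg_left (by positivity) (by positivity)
  have hb : 0 < b := lt_of_lt_of_le ha hab
  gcongr

/-- **Mean-value bound for the radial profile.** For `0 < ρ₀ ≤ a, b` (`μ ≥ 0`):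
`|φ(a) - φ(b)| ≤ (8μ³/(ρ₀³(ρ₀²+2μ))) |a - b|`, `φ(r) = √(r⁴+2μr²) - r² - μ + μ²/(2r²)`.
[cite: BastiCenatiempoSchlein2021, §3, last paragraph] -/
theorem abs_bogoliubov_sub_le {μ ρ₀ a b : ℝ} (hμ : 0 ≤ μ) (hρ₀ : 0 < ρ₀) (ha : ρ₀ ≤ a) (hb : ρ₀ ≤ b) :
    |(Real.sqrt (a ^ 4 + 2 * μ * a ^ 2) - a ^ 2 - μ + μ ^ 2 / (2 * a ^ 2)) -
        (Real.sqrt (b ^ 4 + 2 * μ * b ^ 2) - b ^ 2 - μ + μ ^ 2 / (2 * b ^ 2))| ≤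
      8 * μ ^ 3 / (ρ₀ ^ 3 * (ρ₀ ^ 2 + 2 * μ)) * |a - b| := by
  have h := Convex.norm_image_sub_le_of_norm_hasDerivWithin_le
    (f := fun x => Real.sqrt (x ^ 4 + 2 * μ * x ^ 2) - x ^ 2 - μ + μ ^ 2 / (2 * x ^ 2))
    (f' := fun x => (2 * x ^ 3 + 2 * μ * x) / Real.sqrt (x ^ 4 + 2 * μ * x ^ 2) - 2 * x - μ ^ 2 / x ^ 3)
    (s := Set.Ici ρ₀) (C := 8 * μ ^ 3 / (ρ₀ ^ 3 * (ρ₀ ^ 2 + 2 * μ)))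
    (fun x hx => (hasDerivAt_bogoliubov hμ (lt_of_lt_of_le hρ₀ hx)).hasDerivWithinAt)
    (fun x hx => by
      rw [Real.norm_eq_abs]
      exact (abs_deriv_bogoliubov_le hμ (lt_of_lt_of_le hρ₀ hx)).trans
        (derivBound_antitone hμ hρ₀ hx))
    (convex_Ici ρ₀) hb ha
  simpa only [Real.norm_eq_abs] using h

/-! ### Cubes of the lattice `hℤ³`: `Q_n = h·n + [0,h)³` -/

/-- A non-zero lattice vector of `hℤ³` has norm at least `h` (`h ≥ 0`). [folklore] -/
theorem le_norm_latticeVec_of_ne_zero {h : ℝ} (hh : 0 ≤ h) {n : Fin 3 → ℤ} (hn : n ≠ 0) :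
    h ≤ ‖latticeVec h n‖ := by
  obtain ⟨k, hk⟩ : ∃ k, n k ≠ 0 := by
    by_contra hcon
    push Not at hcon
    exact hn (funext hcon)
  have h1 : (1 : ℝ) ≤ |(n k : ℝ)| := by
    rw [← Int.cast_abs, ← Int.cast_one, Int.cast_le]
    exact Int.one_le_abs hk
  calc h = h * 1 := (mul_one h).symm
    _ ≤ h * |(n k : ℝ)| := mul_le_mul_of_nonneg_left h1 hh
    _ = |latticeVec h n k| := by rw [show latticeVec h n k = h * n k from rfl, abs_mul, abs_of_nonneg hh]
    _ ≤ ‖latticeVec h n‖ := by simpa using PiLp.norm_apply_le (latticeVec h n) k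

/-- The cube `{x : x - h·n ∈ [0,h)³}` is measurable. [folklore] -/
theorem measurableSet_cube (h : ℝ) (n : Fin 3 → ℤ) :
    MeasurableSet ((fun x : Space => x - latticeVec h n) ⁻¹' cell h) :=
  (measurableSet_cell h).preimage (measurable_sub_const _)

/-- The cube `{x : x - h·n ∈ [0,h)³}` has volume `h³`. [folklore] -/
theorem volume_cube (h : ℝ) (n : Fin 3 → ℤ) :
    volume ((fun x : Space => x - latticeVec h n) ⁻¹' cell h) = ENNReal.ofReal h ^ 3 := by
  have : (fun x : Space => x - latticeVec h n) = fun x => x + -latticeVec h n := by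
    funext x; exact sub_eq_add_neg x _
  rw [this, measure_preimage_add_right, volume_cell]

/-- A point of the cube `h·n + [0,h)³` is within `√3·h` of its corner (`h > 0`). [folklore] -/
theorem norm_sub_latticeVec_le {h : ℝ} (hh : 0 < h) {n : Fin 3 → ℤ} {x : Space}
    (hx : x ∈ (fun x : Space => x - latticeVec h n) ⁻¹' cell h) :
    ‖x - latticeVec h n‖ ≤ Real.sqrt 3 * h := by
  set y := x - latticeVec h n with hy
  have hyk : ∀ k, y k ∈ Set.Ico 0 h := hx
  rw [EuclideanSpace.norm_eq, show Real.sqrt 3 * h = Real.sqrt (3 * h ^ 2) by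
    rw [Real.sqrt_mul (by norm_num), Real.sqrt_sq hh.le]]
  refine Real.sqrt_le_sqrt ?_
  calc ∑ k, ‖y k‖ ^ 2 ≤ ∑ _k : Fin 3, h ^ 2 := by
        refine Finset.sum_le_sum fun k _ => ?_
        have h1 := hyk k
        rw [Real.norm_eq_abs, sq_abs]
        nlinarith [h1.1, h1.2]
    _ = 3 * h ^ 2 := by simp

/-- Consequently `|‖x‖ - ‖h·n‖| ≤ √3·h` on the cube. [folklore] -/
theorem abs_norm_sub_norm_latticeVec_le {h : ℝ} (hh : 0 < h) {n : Fin 3 → ℤ} {x : Space}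
    (hx : x ∈ (fun x : Space => x - latticeVec h n) ⁻¹' cell h) :
    |‖x‖ - ‖latticeVec h n‖| ≤ Real.sqrt 3 * h :=
  (abs_norm_sub_norm_le x (latticeVec h n)).trans (norm_sub_latticeVec_le hh hx)

/-- Distinct lattice points give disjoint cubes (`h > 0`). [folklore] -/
theorem disjoint_cube {h : ℝ} (hh : 0 < h) {n m : Fin 3 → ℤ} (hnm : n ≠ m) :
    Disjoint ((fun x : Space => x - latticeVec h n) ⁻¹' cell h)
      ((fun x : Space => x - latticeVec h m) ⁻¹' cell h) := by
  rw [Set.disjoint_left]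
  intro x hxn hxm
  apply hnm
  funext k
  have h1 : (x - latticeVec h n) k ∈ Set.Ico 0 h := hxn k
  have h2 : (x - latticeVec h m) k ∈ Set.Ico 0 h := hxm k
  rw [show (x - latticeVec h n) k = x k - h * n k from rfl, Set.mem_Ico] at h1
  rw [show (x - latticeVec h m) k = x k - h * m k from rfl, Set.mem_Ico] at h2
  have h3 : h * ((n k : ℝ) - m k) < h * 1 := by linarith [h1.1, h2.2]
  have h4 : h * ((m k : ℝ) - n k) < h * 1 := by linarith [h2.1, h1.2]
  have h5 : (n k : ℝ) - m k < 1 := lt_of_mul_lt_mul_left h3 hh.le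
  have h6 : (m k : ℝ) - n k < 1 := lt_of_mul_lt_mul_left h4 hh.le
  have h7 : ((n k - m k : ℤ) : ℝ) < 1 := by push_cast; exact h5
  have h8 : ((m k - n k : ℤ) : ℝ) < 1 := by push_cast; exact h6
  have h9 : n k - m k < 1 := by exact_mod_cast h7
  have h10 : m k - n k < 1 := by exact_mod_cast h8
  omega

/-! ### Counting lattice points in a ball -/

/-- **Lattice points in a ball.** For `h > 0`, `ϱ ≥ 0` and any finite `S ⊆ ℤ³`:
`#{n ∈ S : ‖h·n‖ < ϱ} ≤ (2ϱ/h + 1)³` (each coordinate has fewer than `2ϱ/h + 1` choices).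
[folklore] -/
theorem card_filter_norm_latticeVec_lt_le {h : ℝ} (hh : 0 < h) {ϱ : ℝ} (hϱ : 0 ≤ ϱ)
    (S : Finset (Fin 3 → ℤ)) :
    ((S.filter fun n => ‖latticeVec h n‖ < ϱ).card : ℝ) ≤ (2 * ϱ / h + 1) ^ 3 := by
  set B : ℤ := ⌈ϱ / h⌉ with hB
  have hsub : (S.filter fun n => ‖latticeVec h n‖ < ϱ) ⊆
      Fintype.piFinset fun _ : Fin 3 => Finset.Ioo (-B) B := by
    intro n hn
    rw [Finset.mem_filter] at hn
    rw [Fintype.mem_piFinset]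
    intro k
    rw [Finset.mem_Ioo]
    have h1 : |h * (n k : ℝ)| < ϱ := by
      calc |h * (n k : ℝ)| = |latticeVec h n k| := rfl
        _ ≤ ‖latticeVec h n‖ := by simpa using PiLp.norm_apply_le (latticeVec h n) k
        _ < ϱ := hn.2
    rw [abs_mul, abs_of_pos hh] at h1
    have h2 : |(n k : ℝ)| < ϱ / h := by rwa [lt_div_iff₀ hh, mul_comm]
    have h3 := abs_lt.1 h2
    have hBle : ϱ / h ≤ B := Int.le_ceil _
    constructor
    · have : (-(B : ℝ)) < n k := by linarith [h3.1]
      exact_mod_cast this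
    · have : (n k : ℝ) < B := by linarith [h3.2]
      exact_mod_cast this
  have hcard := Finset.card_le_card hsub
  rw [Fintype.card_piFinset, Finset.prod_const, Finset.card_univ, Fintype.card_fin, Int.card_Ioo] at hcard
  have hB1 : (B : ℝ) < ϱ / h + 1 := Int.ceil_lt_add_one _
  have htoNat : ((B - -B - 1).toNat : ℝ) ≤ 2 * ϱ / h + 1 := by
    rcases le_or_gt 0 (B - -B - 1) with h0 | h0
    · have : ((B - -B - 1).toNat : ℤ) = B - -B - 1 := Int.toNat_of_nonneg h0
      have h' : ((B - -B - 1).toNat : ℝ) = (B : ℝ) - -B - 1 := by exact_mod_cast this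
      rw [h']
      have : 2 * ϱ / h = 2 * (ϱ / h) := by ring
      linarith
    · rw [Int.toNat_eq_zero.2 h0.le]
      push_cast
      positivity
  calc ((S.filter fun n => ‖latticeVec h n‖ < ϱ).card : ℝ)
      ≤ (((B - -B - 1).toNat ^ 3 : ℕ) : ℝ) := by exact_mod_cast hcard
    _ = ((B - -B - 1).toNat : ℝ) ^ 3 := by push_cast; ring
    _ ≤ (2 * ϱ / h + 1) ^ 3 := by gcongr

/-! ### Dyadic shells: `∑_{n ∈ S, ‖hn‖ ≥ c₀h} ‖hn‖^{-7/2} ≤ 1458 h⁻³ (c₀h)^{-1/2}` -/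

/-- The shell index `k(n) = log₄ ⌊‖h·n‖/δ⌋` places `n` with `‖h·n‖ ≥ δ > 0` in the shell
`δ4ᵏ ≤ ‖h·n‖ < δ4ᵏ⁺¹`. [folklore] -/
theorem shell_bounds {h δ : ℝ} (hδ : 0 < δ) {n : Fin 3 → ℤ} (hn : δ ≤ ‖latticeVec h n‖) :
    δ * 4 ^ Nat.log 4 ⌊‖latticeVec h n‖ / δ⌋₊ ≤ ‖latticeVec h n‖ ∧
      ‖latticeVec h n‖ < δ * 4 ^ (Nat.log 4 ⌊‖latticeVec h n‖ / δ⌋₊ + 1) := by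
  set t := ‖latticeVec h n‖ / δ with ht
  have ht1 : 1 ≤ t := by rwa [ht, le_div_iff₀ hδ, one_mul]
  have ht0 : 0 ≤ t := by linarith
  set m := ⌊t⌋₊ with hm
  have hm1 : 1 ≤ m := Nat.le_floor (by exact_mod_cast ht1)
  have hm0 : m ≠ 0 := by omega
  have hlow : 4 ^ Nat.log 4 m ≤ m := Nat.pow_log_le_self 4 hm0
  have hup : m < 4 ^ (Nat.log 4 m + 1) := Nat.lt_pow_succ_log_self (by norm_num) m
  have hmt : (m : ℝ) ≤ t := Nat.floor_le ht0
  have htm : t < m + 1 := Nat.lt_floor_add_one t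
  have heq : ‖latticeVec h n‖ = δ * t := by rw [ht]; field_simp
  constructor
  · rw [heq]
    refine mul_le_mul_of_nonneg_left ?_ hδ.le
    calc ((4 : ℝ) ^ Nat.log 4 m) = ((4 ^ Nat.log 4 m : ℕ) : ℝ) := by push_cast; ring
      _ ≤ m := by exact_mod_cast hlow
      _ ≤ t := hmt
  · rw [heq]
    refine mul_lt_mul_of_pos_left ?_ hδ
    have hup' : (m : ℝ) + 1 ≤ (4 : ℝ) ^ (Nat.log 4 m + 1) := by
      have : m + 1 ≤ 4 ^ (Nat.log 4 m + 1) := hup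
      exact_mod_cast this
    linarith

/-- **The shell sum.** For `h > 0`, `c₀ ≥ 1` and every finite `S ⊆ ℤ³`:
`∑_{n ∈ S, ‖h·n‖ ≥ c₀h} ‖h·n‖⁻³ ‖h·n‖^{-1/2} ≤ 1458 / (h³ √(c₀h))` — decompose into the shells
`c₀h·4ᵏ ≤ ‖h·n‖ < c₀h·4ᵏ⁺¹`, each holding at most `(9c₀4ᵏ)³` lattice points
(`card_filter_norm_latticeVec_lt_le`), and sum the geometric series `∑ 2⁻ᵏ ≤ 2`. [folklore] -/
theorem sum_shells_le {h c₀ : ℝ} (hh : 0 < h) (hc₀ : 1 ≤ c₀) (S : Finset (Fin 3 → ℤ)) :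
    ∑ n ∈ S.filter (fun n => c₀ * h ≤ ‖latticeVec h n‖),
        1 / (‖latticeVec h n‖ ^ 3 * Real.sqrt ‖latticeVec h n‖) ≤
      1458 / (h ^ 3 * Real.sqrt (c₀ * h)) := by
  set δ := c₀ * h with hδdef
  have hδ : 0 < δ := by positivity
  have hsδ : 0 < Real.sqrt δ := Real.sqrt_pos.2 hδ
  set S' := S.filter (fun n => δ ≤ ‖latticeVec h n‖) with hS'
  set kf : (Fin 3 → ℤ) → ℕ := fun n => Nat.log 4 ⌊‖latticeVec h n‖ / δ⌋₊ with hkf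
  have hmaps : ∀ n ∈ S', kf n ∈ S'.image kf := fun n hn => Finset.mem_image_of_mem kf hn
  rw [← Finset.sum_fiberwise_of_maps_to hmaps]
  -- each shell
  have hshell : ∀ k ∈ S'.image kf,
      ∑ n ∈ S'.filter (fun n => kf n = k), 1 / (‖latticeVec h n‖ ^ 3 * Real.sqrt ‖latticeVec h n‖) ≤
        729 * c₀ ^ 3 / (δ ^ 3 * Real.sqrt δ) * (1 / 2) ^ k := by
    intro k _
    have h4k : (0 : ℝ) < 4 ^ k := by positivity
    -- the term bound on the shell
    have hterm : ∀ n ∈ S'.filter (fun n => kf n = k),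
        1 / (‖latticeVec h n‖ ^ 3 * Real.sqrt ‖latticeVec h n‖) ≤
          1 / ((δ * 4 ^ k) ^ 3 * (Real.sqrt δ * 2 ^ k)) := by
      intro n hn
      rw [Finset.mem_filter] at hn
      obtain ⟨hnS', hnk⟩ := hn
      have hnδ : δ ≤ ‖latticeVec h n‖ := (Finset.mem_filter.1 hnS').2
      have hb := (shell_bounds hδ hnδ).1
      rw [show Nat.log 4 ⌊‖latticeVec h n‖ / δ⌋₊ = k from hnk] at hb
      have hpos : 0 < δ * 4 ^ k := by positivity
      have hsq : Real.sqrt δ * 2 ^ k = Real.sqrt (δ * 4 ^ k) := by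
        rw [Real.sqrt_mul hδ.le, show ((4 : ℝ) ^ k) = (2 ^ k) ^ 2 by
          rw [← pow_mul, mul_comm, pow_mul]; norm_num, Real.sqrt_sq (by positivity)]
      rw [hsq]
      apply div_le_div_of_nonneg_left zero_le_one (by positivity)
      gcongr
    -- the number of points on the shell
    have hcard : ((S'.filter (fun n => kf n = k)).card : ℝ) ≤ 729 * c₀ ^ 3 * 64 ^ k := by
      have hsub : S'.filter (fun n => kf n = k) ⊆ S.filter (fun n => ‖latticeVec h n‖ < δ * 4 ^ (k + 1)) := by
        intro n hn
        rw [Finset.mem_filter] at hn ⊢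
        obtain ⟨hnS', hnk⟩ := hn
        have hnS := Finset.mem_filter.1 hnS'
        have hb := (shell_bounds hδ hnS.2).2
        rw [show Nat.log 4 ⌊‖latticeVec h n‖ / δ⌋₊ = k from hnk] at hb
        exact ⟨hnS.1, hb⟩
      calc ((S'.filter (fun n => kf n = k)).card : ℝ)
          ≤ ((S.filter (fun n => ‖latticeVec h n‖ < δ * 4 ^ (k + 1))).card : ℝ) := by
            exact_mod_cast Finset.card_le_card hsub
        _ ≤ (2 * (δ * 4 ^ (k + 1)) / h + 1) ^ 3 :=
            card_filter_norm_latticeVec_lt_le hh (by positivity) S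
        _ = (8 * c₀ * 4 ^ k + 1) ^ 3 := by
            rw [hδdef]; congr 1; field_simp; ring
        _ ≤ (9 * c₀ * 4 ^ k) ^ 3 := by
            have : (1 : ℝ) ≤ c₀ * 4 ^ k := by
              calc (1 : ℝ) = 1 * 1 := by norm_num
                _ ≤ c₀ * 4 ^ k := mul_le_mul hc₀ (one_le_pow₀ (by norm_num)) zero_le_one (by linarith)
            gcongr; linarith
        _ = 729 * c₀ ^ 3 * 64 ^ k := by
            rw [show (64 : ℝ) = 4 ^ 3 by norm_num, ← pow_mul, mul_comm 3 k, pow_mul]; ring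
    calc ∑ n ∈ S'.filter (fun n => kf n = k), 1 / (‖latticeVec h n‖ ^ 3 * Real.sqrt ‖latticeVec h n‖)
        ≤ (S'.filter (fun n => kf n = k)).card • (1 / ((δ * 4 ^ k) ^ 3 * (Real.sqrt δ * 2 ^ k))) :=
          Finset.sum_le_card_nsmul _ _ _ hterm
      _ = ((S'.filter (fun n => kf n = k)).card : ℝ) * (1 / ((δ * 4 ^ k) ^ 3 * (Real.sqrt δ * 2 ^ k))) := by
          rw [nsmul_eq_mul]
      _ ≤ (729 * c₀ ^ 3 * 64 ^ k) * (1 / ((δ * 4 ^ k) ^ 3 * (Real.sqrt δ * 2 ^ k))) := by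
          gcongr
      _ = 729 * c₀ ^ 3 / (δ ^ 3 * Real.sqrt δ) * (1 / 2) ^ k := by
          have h64 : (64 : ℝ) ^ k = (4 ^ k) ^ 3 := by
            rw [← pow_mul, mul_comm k 3, pow_mul]; norm_num
          rw [h64]
          field_simp
          rw [← mul_pow]; norm_num
  -- sum over the shells
  have hgeom : ∑ k ∈ S'.image kf, ((1 : ℝ) / 2) ^ k ≤ 2 := by
    have hs : Summable (fun k : ℕ => ((1 : ℝ) / 2) ^ k) :=
      summable_geometric_of_lt_one (by norm_num) (by norm_num)
    calc ∑ k ∈ S'.image kf, ((1 : ℝ) / 2) ^ k ≤ ∑' k : ℕ, ((1 : ℝ) / 2) ^ k :=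
          hs.sum_le_tsum _ (fun k _ => by positivity)
      _ = 2 := by rw [tsum_geometric_of_lt_one (by norm_num) (by norm_num)]; norm_num
  calc ∑ k ∈ S'.image kf, ∑ n ∈ S'.filter (fun n => kf n = k),
        1 / (‖latticeVec h n‖ ^ 3 * Real.sqrt ‖latticeVec h n‖)
      ≤ ∑ k ∈ S'.image kf, 729 * c₀ ^ 3 / (δ ^ 3 * Real.sqrt δ) * (1 / 2) ^ k :=
        Finset.sum_le_sum hshell
    _ = 729 * c₀ ^ 3 / (δ ^ 3 * Real.sqrt δ) * ∑ k ∈ S'.image kf, ((1 : ℝ) / 2) ^ k := by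
        rw [Finset.mul_sum]
    _ ≤ 729 * c₀ ^ 3 / (δ ^ 3 * Real.sqrt δ) * 2 := by gcongr
    _ = 1458 / (h ^ 3 * Real.sqrt (c₀ * h)) := by
        rw [hδdef]
        have hc0 : 0 < c₀ := by linarith
        field_simp
        ring

/-! ### The far cubes: `h³F(h·n) ≤ ∫_{Q_n} F + h³·(64√6) h μ³/(μ^{3/4} ‖h·n‖^{7/2})` -/

/-- Young's inequality `u t³ ≤ u⁴ + t⁴` (`u, t ≥ 0`), from `u⁴ + 3t⁴ - 4ut³ = (u-t)²(u²+2ut+3t²)`.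
[folklore] -/
theorem mul_cube_le_pow_four_add {u t : ℝ} (hu : 0 ≤ u) (ht : 0 ≤ t) : u * t ^ 3 ≤ u ^ 4 + t ^ 4 := by
  nlinarith [mul_nonneg (sq_nonneg (u - t)) (by positivity : 0 ≤ u ^ 2 + 2 * u * t + 3 * t ^ 2),
    pow_nonneg ht 4]

/-- `(ρ/2)² + 2μ ≥ √(ρ/2) · (μ^{1/4})³` (`ρ ≥ 0`, `μ ≥ 0`). [folklore] -/
theorem sqrt_mul_cube_le {ρ μ : ℝ} (hρ : 0 ≤ ρ) (hμ : 0 ≤ μ) :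
    Real.sqrt (ρ / 2) * Real.sqrt (Real.sqrt μ) ^ 3 ≤ (ρ / 2) ^ 2 + 2 * μ := by
  have hu : Real.sqrt (ρ / 2) ^ 4 = (ρ / 2) ^ 2 := by
    rw [show (4 : ℕ) = 2 * 2 by norm_num, pow_mul, Real.sq_sqrt (by positivity)]
  have ht : Real.sqrt (Real.sqrt μ) ^ 4 = μ := by
    rw [show (4 : ℕ) = 2 * 2 by norm_num, pow_mul, Real.sq_sqrt (Real.sqrt_nonneg _),
      Real.sq_sqrt hμ]
  have h := mul_cube_le_pow_four_add (Real.sqrt_nonneg (ρ / 2)) (Real.sqrt_nonneg (Real.sqrt μ))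
  rw [hu, ht] at h
  linarith

/-- The derivative majorant at `ρ/2` in the `ρ^{-7/2}` form:
`8μ³/((ρ/2)³((ρ/2)²+2μ)) ≤ 64√2 μ³/((μ^{1/4})³ ρ³ √ρ)` (`ρ, μ > 0`). [folklore] -/
theorem derivBound_half_le {ρ μ : ℝ} (hρ : 0 < ρ) (hμ : 0 < μ) :
    8 * μ ^ 3 / ((ρ / 2) ^ 3 * ((ρ / 2) ^ 2 + 2 * μ)) ≤
      64 * Real.sqrt 2 * μ ^ 3 / (Real.sqrt (Real.sqrt μ) ^ 3 * (ρ ^ 3 * Real.sqrt ρ)) := by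
  have ha : 0 < Real.sqrt (Real.sqrt μ) := Real.sqrt_pos.2 (Real.sqrt_pos.2 hμ)
  have hsρ : 0 < Real.sqrt ρ := Real.sqrt_pos.2 hρ
  have hs2 : 0 < Real.sqrt 2 := Real.sqrt_pos.2 (by norm_num)
  have hkey := sqrt_mul_cube_le hρ.le hμ.le
  have hhalf : Real.sqrt (ρ / 2) = Real.sqrt ρ / Real.sqrt 2 := Real.sqrt_div' ρ (by norm_num)
  rw [hhalf] at hkey
  -- `8μ³/((ρ/2)³·X) ≤ 8μ³/((ρ/2)³ · (√ρ/√2) a³)` with `X ≥ (√ρ/√2)a³`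
  calc 8 * μ ^ 3 / ((ρ / 2) ^ 3 * ((ρ / 2) ^ 2 + 2 * μ))
      ≤ 8 * μ ^ 3 / ((ρ / 2) ^ 3 * (Real.sqrt ρ / Real.sqrt 2 * Real.sqrt (Real.sqrt μ) ^ 3)) := by
        apply div_le_div_of_nonneg_left (by positivity) (by positivity)
        gcongr
    _ = 64 * Real.sqrt 2 * μ ^ 3 / (Real.sqrt (Real.sqrt μ) ^ 3 * (ρ ^ 3 * Real.sqrt ρ)) := by
        field_simp
        ring

/-- **Comparison on a far cube.** Let `μ, h > 0` and `‖h·n‖ ≥ 2√3·h`. For every `x` in the cube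
`h·n + [0,h)³`: `F_μ(h·n) ≤ F_μ(x) + 64√6 · h μ³/((μ^{1/4})³ ‖h·n‖³ √‖h·n‖)`, where
`F_μ(p) = √(|p|⁴+2μ|p|²) - |p|² - μ + μ²/(2|p|²)` (radial mean-value bound with `|∇F_μ| ≤ 8μ³/(r³(r²+2μ))`
on `|p| ≥ ‖h·n‖/2`). [cite: BastiCenatiempoSchlein2021, §3, last paragraph] -/
theorem bogoliubov_latticeVec_le_add {μ h : ℝ} (hμ : 0 < μ) (hh : 0 < h) {n : Fin 3 → ℤ}
    (hn : 2 * Real.sqrt 3 * h ≤ ‖latticeVec h n‖) {x : Space}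
    (hx : x ∈ (fun x : Space => x - latticeVec h n) ⁻¹' cell h) :
    Real.sqrt (‖latticeVec h n‖ ^ 4 + 2 * μ * ‖latticeVec h n‖ ^ 2) - ‖latticeVec h n‖ ^ 2 - μ +
        μ ^ 2 / (2 * ‖latticeVec h n‖ ^ 2) ≤
      (Real.sqrt (‖x‖ ^ 4 + 2 * μ * ‖x‖ ^ 2) - ‖x‖ ^ 2 - μ + μ ^ 2 / (2 * ‖x‖ ^ 2)) +
        64 * Real.sqrt 6 * h * μ ^ 3 /
          (Real.sqrt (Real.sqrt μ) ^ 3 * (‖latticeVec h n‖ ^ 3 * Real.sqrt ‖latticeVec h n‖)) := by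
  set ρ := ‖latticeVec h n‖ with hρdef
  have h3 : 0 < Real.sqrt 3 := Real.sqrt_pos.2 (by norm_num)
  have hρ0 : 0 < ρ := lt_of_lt_of_le (by positivity) hn
  have hdist : |‖x‖ - ρ| ≤ Real.sqrt 3 * h := abs_norm_sub_norm_latticeVec_le hh hx
  have hxρ : ρ / 2 ≤ ‖x‖ := by
    have := (abs_le.1 hdist).1
    linarith
  have hρρ : ρ / 2 ≤ ρ := by linarith
  have hmvt := abs_bogoliubov_sub_le hμ.le (by positivity : 0 < ρ / 2) hρρ hxρ
  have hM := derivBound_half_le hρ0 hμ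
  have habs : |ρ - ‖x‖| ≤ Real.sqrt 3 * h := by rw [abs_sub_comm]; exact hdist
  have hbound : |(Real.sqrt (ρ ^ 4 + 2 * μ * ρ ^ 2) - ρ ^ 2 - μ + μ ^ 2 / (2 * ρ ^ 2)) -
      (Real.sqrt (‖x‖ ^ 4 + 2 * μ * ‖x‖ ^ 2) - ‖x‖ ^ 2 - μ + μ ^ 2 / (2 * ‖x‖ ^ 2))| ≤
      64 * Real.sqrt 6 * h * μ ^ 3 / (Real.sqrt (Real.sqrt μ) ^ 3 * (ρ ^ 3 * Real.sqrt ρ)) := by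
    calc _ ≤ 8 * μ ^ 3 / ((ρ / 2) ^ 3 * ((ρ / 2) ^ 2 + 2 * μ)) * |ρ - ‖x‖| := hmvt
      _ ≤ 64 * Real.sqrt 2 * μ ^ 3 / (Real.sqrt (Real.sqrt μ) ^ 3 * (ρ ^ 3 * Real.sqrt ρ)) *
            (Real.sqrt 3 * h) := mul_le_mul hM habs (abs_nonneg _) (by positivity)
      _ = 64 * Real.sqrt 6 * h * μ ^ 3 / (Real.sqrt (Real.sqrt μ) ^ 3 * (ρ ^ 3 * Real.sqrt ρ)) := by
            rw [show (6 : ℝ) = 2 * 3 by norm_num, Real.sqrt_mul (by norm_num)]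
            ring
  have := (abs_le.1 hbound).2
  linarith

/-- **Integrated comparison on a far cube**: with `Q_n = h·n + [0,h)³`, `‖h·n‖ ≥ 2√3·h`,
`h³ F_μ(h·n) ≤ ∫_{Q_n} F_μ + h³ · 64√6 · h μ³/((μ^{1/4})³ ‖h·n‖³ √‖h·n‖)`.
[cite: BastiCenatiempoSchlein2021, §3, last paragraph] -/
theorem cube_mul_bogoliubov_latticeVec_le {μ h : ℝ} (hμ : 0 < μ) (hh : 0 < h) {n : Fin 3 → ℤ}
    (hn : 2 * Real.sqrt 3 * h ≤ ‖latticeVec h n‖) :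
    h ^ 3 * (Real.sqrt (‖latticeVec h n‖ ^ 4 + 2 * μ * ‖latticeVec h n‖ ^ 2) - ‖latticeVec h n‖ ^ 2 - μ +
        μ ^ 2 / (2 * ‖latticeVec h n‖ ^ 2)) ≤
      (∫ x in (fun x : Space => x - latticeVec h n) ⁻¹' cell h,
          (Real.sqrt (‖x‖ ^ 4 + 2 * μ * ‖x‖ ^ 2) - ‖x‖ ^ 2 - μ + μ ^ 2 / (2 * ‖x‖ ^ 2))) +
        h ^ 3 * (64 * Real.sqrt 6 * h * μ ^ 3 /
          (Real.sqrt (Real.sqrt μ) ^ 3 * (‖latticeVec h n‖ ^ 3 * Real.sqrt ‖latticeVec h n‖))) := by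
  set Q := (fun x : Space => x - latticeVec h n) ⁻¹' cell h with hQ
  set E := 64 * Real.sqrt 6 * h * μ ^ 3 /
    (Real.sqrt (Real.sqrt μ) ^ 3 * (‖latticeVec h n‖ ^ 3 * Real.sqrt ‖latticeVec h n‖)) with hE
  set c := Real.sqrt (‖latticeVec h n‖ ^ 4 + 2 * μ * ‖latticeVec h n‖ ^ 2) - ‖latticeVec h n‖ ^ 2 - μ +
    μ ^ 2 / (2 * ‖latticeVec h n‖ ^ 2) with hc
  have hvol : volume Q = ENNReal.ofReal h ^ 3 := volume_cube h n
  have hreal : (volume : Measure Space).real Q = h ^ 3 := by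
    rw [measureReal_def, hvol, ← ENNReal.ofReal_pow hh.le, ENNReal.toReal_ofReal (by positivity)]
  have hle : ∀ x ∈ Q, c - E ≤
      Real.sqrt (‖x‖ ^ 4 + 2 * μ * ‖x‖ ^ 2) - ‖x‖ ^ 2 - μ + μ ^ 2 / (2 * ‖x‖ ^ 2) := by
    intro x hx
    have := bogoliubov_latticeVec_le_add hμ hh hn hx
    linarith
  have hint := setIntegral_ge_of_const_le_real (measurableSet_cube h n)
    (by rw [hvol]; exact ENNReal.pow_ne_top ENNReal.ofReal_ne_top) hle
    (integrable_bogoliubov hμ).integrableOn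
  rw [hreal] at hint
  nlinarith [hint, pow_pos hh 3]

/-! ### Assembly: the lattice sum is bounded by the integral -/

/-- `F_μ ≥ 0` almost everywhere (everywhere off the origin). [folklore] -/
theorem bogoliubov_ae_nonneg {μ : ℝ} (hμ : 0 ≤ μ) :
    0 ≤ᵐ[volume] fun p : Space =>
      Real.sqrt (‖p‖ ^ 4 + 2 * μ * ‖p‖ ^ 2) - ‖p‖ ^ 2 - μ + μ ^ 2 / (2 * ‖p‖ ^ 2) := by
  have h0 : ({0} : Set Space)ᶜ ∈ ae (volume : Measure Space) := by
    rw [compl_mem_ae_iff]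
    exact measure_singleton 0
  filter_upwards [h0] with p hp
  have hp' : 0 < ‖p‖ := norm_pos_iff.2 hp
  exact bogoliubov_nonneg hμ hp'

/-- **The Lee–Huang–Yang lattice sum is bounded by the integral (raw form).** For `μ, h > 0` and
every finite set `S ⊆ ℤ³ ∖ {0}`, with `F_μ(p) = √(|p|⁴+2μ|p|²) - |p|² - μ + μ²/(2|p|²) ≥ 0`:
`h³ ∑_{n ∈ S} F_μ(h·n) ≤ ∫_{ℝ³} F_μ + 279936 μ²√μ √(h/√μ) + 512 μ² h`.
Proof: lattice points with `‖h·n‖ ≥ 2√3h` are compared with the integral over their cubes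
`h·n + [0,h)³` (`cube_mul_bogoliubov_latticeVec_le`, disjoint cubes, `F_μ ≥ 0`), the sum of the
cube errors being `O(μ^{9/4} h^{1/2})` by the shell count (`sum_shells_le`); the at most `512`
points with `‖h·n‖ < 2√3h` contribute at most `μ²/h²` each (`bogoliubov_le_sq_div`, `‖h·n‖ ≥ h`).
This is the Riemann-sum step "(3.20) ⇒ (3.21)" of [BastiCenatiempoSchlein2021, §3] (there with
`h = 2πN^{-κ/2}`, `μ = 8π𝔞`), in the one-sided form needed for an UPPER bound (for which the
restriction of the sum to `P_L` costs nothing, `F_μ` being non-negative).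
[cite: BastiCenatiempoSchlein2021, §3, (3.20)–(3.21) and the last paragraph of the section] -/
theorem cube_mul_latticeSum_bogoliubov_le {μ h : ℝ} (hμ : 0 < μ) (hh : 0 < h)
    {S : Finset (Fin 3 → ℤ)} (h0 : (0 : Fin 3 → ℤ) ∉ S) :
    h ^ 3 * ∑ n ∈ S, (Real.sqrt (‖latticeVec h n‖ ^ 4 + 2 * μ * ‖latticeVec h n‖ ^ 2) -
        ‖latticeVec h n‖ ^ 2 - μ + μ ^ 2 / (2 * ‖latticeVec h n‖ ^ 2)) ≤
      (∫ p : Space, (Real.sqrt (‖p‖ ^ 4 + 2 * μ * ‖p‖ ^ 2) - ‖p‖ ^ 2 - μ + μ ^ 2 / (2 * ‖p‖ ^ 2))) +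
        279936 * μ ^ 2 * Real.sqrt μ * Real.sqrt (h / Real.sqrt μ) + 512 * μ ^ 2 * h := by
  -- notation
  set F : Space → ℝ := fun p =>
    Real.sqrt (‖p‖ ^ 4 + 2 * μ * ‖p‖ ^ 2) - ‖p‖ ^ 2 - μ + μ ^ 2 / (2 * ‖p‖ ^ 2) with hF
  set a := Real.sqrt (Real.sqrt μ) with hadef
  have ha : 0 < a := Real.sqrt_pos.2 (Real.sqrt_pos.2 hμ)
  have ha2 : a ^ 2 = Real.sqrt μ := Real.sq_sqrt (Real.sqrt_nonneg μ)
  have hsμ : 0 < Real.sqrt μ := Real.sqrt_pos.2 hμ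
  have hsμ2 : Real.sqrt μ ^ 2 = μ := Real.sq_sqrt hμ.le
  have h3 : 0 < Real.sqrt 3 := Real.sqrt_pos.2 (by norm_num)
  have h3sq : Real.sqrt 3 ^ 2 = 3 := Real.sq_sqrt (by norm_num)
  have h3le : Real.sqrt 3 ≤ 7 / 4 := by
    rw [Real.sqrt_le_left (by norm_num)]; norm_num
  have hc₀ : (1 : ℝ) ≤ 2 * Real.sqrt 3 := by nlinarith
  set δ := 2 * Real.sqrt 3 * h with hδdef
  have hδ : 0 < δ := by positivity
  -- split into far and near points
  set Sfar := S.filter (fun n => δ ≤ ‖latticeVec h n‖) with hSfar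
  set Snear := S.filter (fun n => ¬ δ ≤ ‖latticeVec h n‖) with hSnear
  have hsplit : ∑ n ∈ S, F (latticeVec h n) =
      ∑ n ∈ Sfar, F (latticeVec h n) + ∑ n ∈ Snear, F (latticeVec h n) :=
    (Finset.sum_filter_add_sum_filter_not S _ _).symm
  -- the far points: cube comparison
  have hfar : h ^ 3 * ∑ n ∈ Sfar, F (latticeVec h n) ≤
      (∫ p, F p) + 279936 * μ ^ 2 * Real.sqrt μ * Real.sqrt (h / Real.sqrt μ) := by
    have hstep : ∀ n ∈ Sfar, h ^ 3 * F (latticeVec h n) ≤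
        (∫ x in (fun x : Space => x - latticeVec h n) ⁻¹' cell h, F x) +
          h ^ 3 * (64 * Real.sqrt 6 * h * μ ^ 3 /
            (a ^ 3 * (‖latticeVec h n‖ ^ 3 * Real.sqrt ‖latticeVec h n‖))) := by
      intro n hn
      have hn' : δ ≤ ‖latticeVec h n‖ := (Finset.mem_filter.1 hn).2
      exact cube_mul_bogoliubov_latticeVec_le hμ hh hn'
    have hsum : h ^ 3 * ∑ n ∈ Sfar, F (latticeVec h n) ≤
        (∑ n ∈ Sfar, ∫ x in (fun x : Space => x - latticeVec h n) ⁻¹' cell h, F x) +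
          h ^ 3 * ∑ n ∈ Sfar, 64 * Real.sqrt 6 * h * μ ^ 3 /
            (a ^ 3 * (‖latticeVec h n‖ ^ 3 * Real.sqrt ‖latticeVec h n‖)) := by
      calc h ^ 3 * ∑ n ∈ Sfar, F (latticeVec h n) = ∑ n ∈ Sfar, h ^ 3 * F (latticeVec h n) :=
            Finset.mul_sum _ _ _
        _ ≤ ∑ n ∈ Sfar, ((∫ x in (fun x : Space => x - latticeVec h n) ⁻¹' cell h, F x) +
              h ^ 3 * (64 * Real.sqrt 6 * h * μ ^ 3 /
                (a ^ 3 * (‖latticeVec h n‖ ^ 3 * Real.sqrt ‖latticeVec h n‖)))) :=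
            Finset.sum_le_sum hstep
        _ = (∑ n ∈ Sfar, ∫ x in (fun x : Space => x - latticeVec h n) ⁻¹' cell h, F x) +
              ∑ n ∈ Sfar, h ^ 3 * (64 * Real.sqrt 6 * h * μ ^ 3 /
                (a ^ 3 * (‖latticeVec h n‖ ^ 3 * Real.sqrt ‖latticeVec h n‖))) :=
            Finset.sum_add_distrib
        _ = _ := by rw [← Finset.mul_sum]
    -- the integrals over the disjoint cubes
    have hcubes : ∑ n ∈ Sfar, ∫ x in (fun x : Space => x - latticeVec h n) ⁻¹' cell h, F x ≤ ∫ p, F p := by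
      rw [← integral_biUnion_finset Sfar (fun n _ => measurableSet_cube h n)
        (fun n _ m _ hnm => disjoint_cube hh hnm)
        (fun n _ => (integrable_bogoliubov hμ).integrableOn)]
      exact setIntegral_le_integral (integrable_bogoliubov hμ) (bogoliubov_ae_nonneg hμ.le)
    -- the cube errors
    have herr : h ^ 3 * ∑ n ∈ Sfar, 64 * Real.sqrt 6 * h * μ ^ 3 /
        (a ^ 3 * (‖latticeVec h n‖ ^ 3 * Real.sqrt ‖latticeVec h n‖)) ≤
        279936 * μ ^ 2 * Real.sqrt μ * Real.sqrt (h / Real.sqrt μ) := by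
      have hshell := sum_shells_le hh hc₀ S
      have hrw : ∑ n ∈ Sfar, 64 * Real.sqrt 6 * h * μ ^ 3 /
          (a ^ 3 * (‖latticeVec h n‖ ^ 3 * Real.sqrt ‖latticeVec h n‖)) =
          64 * Real.sqrt 6 * h * μ ^ 3 / a ^ 3 *
            ∑ n ∈ Sfar, 1 / (‖latticeVec h n‖ ^ 3 * Real.sqrt ‖latticeVec h n‖) := by
        rw [Finset.mul_sum]
        refine Finset.sum_congr rfl fun n _ => ?_
        field_simp
      rw [hrw]
      have h6 : Real.sqrt 6 ≤ 3 := by rw [Real.sqrt_le_left (by norm_num)]; norm_num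
      have hsh : Real.sqrt h ≤ Real.sqrt (2 * Real.sqrt 3 * h) :=
        Real.sqrt_le_sqrt (by nlinarith)
      have hsh0 : 0 < Real.sqrt h := Real.sqrt_pos.2 hh
      have hsqh : Real.sqrt h ^ 2 = h := Real.sq_sqrt hh.le
      have htarget : Real.sqrt (h / Real.sqrt μ) = Real.sqrt h / a := by
        rw [Real.sqrt_div' h (Real.sqrt_nonneg μ), hadef]
      have hS' : ∑ n ∈ Sfar, 1 / (‖latticeVec h n‖ ^ 3 * Real.sqrt ‖latticeVec h n‖) ≤
          1458 / (h ^ 3 * Real.sqrt h) :=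
        hshell.trans (div_le_div_of_nonneg_left (by norm_num) (by positivity) (by gcongr))
      calc h ^ 3 * (64 * Real.sqrt 6 * h * μ ^ 3 / a ^ 3 *
            ∑ n ∈ Sfar, 1 / (‖latticeVec h n‖ ^ 3 * Real.sqrt ‖latticeVec h n‖))
          ≤ h ^ 3 * (64 * 3 * h * μ ^ 3 / a ^ 3 * (1458 / (h ^ 3 * Real.sqrt h))) := by
            gcongr
        _ = 279936 * μ ^ 2 * Real.sqrt μ * Real.sqrt (h / Real.sqrt μ) := by
            rw [htarget]
            have hμa : μ = a ^ 4 := by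
              rw [show (4 : ℕ) = 2 * 2 by norm_num, pow_mul, ha2, hsμ2]
            obtain ⟨sh, hshd⟩ : ∃ sh, Real.sqrt h = sh := ⟨_, rfl⟩
            rw [hshd] at hsqh hsh0 ⊢
            rw [← ha2, hμa, ← hsqh]
            field_simp
            ring
    linarith [hsum, hcubes, herr]
  -- the near points
  have hnear : h ^ 3 * ∑ n ∈ Snear, F (latticeVec h n) ≤ 512 * μ ^ 2 * h := by
    have hterm : ∀ n ∈ Snear, F (latticeVec h n) ≤ μ ^ 2 / h ^ 2 := by
      intro n hn
      have hnS : n ∈ S := (Finset.mem_filter.1 hn).1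
      have hn0 : n ≠ 0 := fun h' => h0 (h' ▸ hnS)
      have hρ : h ≤ ‖latticeVec h n‖ := le_norm_latticeVec_of_ne_zero hh.le hn0
      have hρ0 : 0 < ‖latticeVec h n‖ := lt_of_lt_of_le hh hρ
      calc F (latticeVec h n) ≤ μ ^ 2 / ‖latticeVec h n‖ ^ 2 := bogoliubov_le_sq_div hμ.le hρ0
        _ ≤ μ ^ 2 / h ^ 2 := by
            apply div_le_div_of_nonneg_left (by positivity) (by positivity)
            gcongr
    have hcard : (Snear.card : ℝ) ≤ 512 := by
      have hsub : Snear ⊆ S.filter (fun n => ‖latticeVec h n‖ < δ) := by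
        intro n hn
        rw [Finset.mem_filter] at hn ⊢
        exact ⟨hn.1, not_le.1 hn.2⟩
      calc (Snear.card : ℝ) ≤ ((S.filter (fun n => ‖latticeVec h n‖ < δ)).card : ℝ) := by
            exact_mod_cast Finset.card_le_card hsub
        _ ≤ (2 * δ / h + 1) ^ 3 := card_filter_norm_latticeVec_lt_le hh hδ.le S
        _ = (4 * Real.sqrt 3 + 1) ^ 3 := by rw [hδdef]; field_simp; ring
        _ ≤ 8 ^ 3 := by gcongr; linarith
        _ = 512 := by norm_num
    calc h ^ 3 * ∑ n ∈ Snear, F (latticeVec h n) ≤ h ^ 3 * (Snear.card • (μ ^ 2 / h ^ 2)) := by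
          gcongr
          exact Finset.sum_le_card_nsmul _ _ _ hterm
      _ = Snear.card * (μ ^ 2 * h) := by rw [nsmul_eq_mul]; field_simp
      _ ≤ 512 * (μ ^ 2 * h) := by gcongr
      _ = 512 * μ ^ 2 * h := by ring
  -- conclusion
  rw [hsplit, mul_add]
  linarith [hfar, hnear]

/-- **The Lee–Huang–Yang lattice sum (Riemann-sum upper bound with the explicit integral).** For
`μ, h > 0` and every finite `S ⊆ ℤ³ ∖ {0}`:
`h³ ∑_{n ∈ S} F_μ(h·n) ≤ (32√2π/15) μ^{5/2} + 3·10⁵ μ^{5/2} (√(h/√μ) + h/√μ)`,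
`F_μ(p) = √(|p|⁴+2μ|p|²) - |p|² - μ + μ²/(2|p|²)`; here `(32√2π/15)μ^{5/2} = ∫_{ℝ³} F_μ`
(`integral_bogoliubov`), so that `h³ ∑_{p ∈ hℤ³∖0} F_μ(p) → ∫ F_μ` from below the bound at rate
`O((h/√μ)^{1/2})`. [cite: BastiCenatiempoSchlein2021, §3, (3.20)–(3.21)] -/
theorem cube_mul_latticeSum_bogoliubov_le' {μ h : ℝ} (hμ : 0 < μ) (hh : 0 < h)
    {S : Finset (Fin 3 → ℤ)} (h0 : (0 : Fin 3 → ℤ) ∉ S) :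
    h ^ 3 * ∑ n ∈ S, (Real.sqrt (‖latticeVec h n‖ ^ 4 + 2 * μ * ‖latticeVec h n‖ ^ 2) -
        ‖latticeVec h n‖ ^ 2 - μ + μ ^ 2 / (2 * ‖latticeVec h n‖ ^ 2)) ≤
      32 * Real.sqrt 2 * Real.pi / 15 * μ ^ 2 * Real.sqrt μ +
        300000 * μ ^ 2 * Real.sqrt μ * (Real.sqrt (h / Real.sqrt μ) + h / Real.sqrt μ) := by
  have h1 := cube_mul_latticeSum_bogoliubov_le hμ hh h0
  rw [integral_bogoliubov hμ] at h1
  have hsμ : 0 < Real.sqrt μ := Real.sqrt_pos.2 hμ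
  have hsμ2 : Real.sqrt μ ^ 2 = μ := Real.sq_sqrt hμ.le
  have hx : μ ^ 2 * h = μ ^ 2 * Real.sqrt μ * (h / Real.sqrt μ) := by
    field_simp
  have hnonneg1 : 0 ≤ μ ^ 2 * Real.sqrt μ * Real.sqrt (h / Real.sqrt μ) := by positivity
  have hnonneg2 : 0 ≤ μ ^ 2 * Real.sqrt μ * (h / Real.sqrt μ) := by positivity
  nlinarith [h1, hx, hnonneg1, hnonneg2]

/-- **The Lee–Huang–Yang lattice sum on the torus of side `L`, physical normalisation.** For
`ρ, a, L > 0` and every finite set of non-zero momenta `p = 2πn/L`, `n ∈ S ⊆ ℤ³ ∖ {0}`: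
`½ ∑_{n ∈ S} F_{8πρa}(2πn/L) ≤ L³ · [4πρ²a · (128/(15√π)) √(ρa³) + ½(2π)⁻³ · 3·10⁵ μ^{5/2}(√(h/√μ) + h/√μ)]`
with `μ = 8πρa`, `h = 2π/L`: one half of the Bogoliubov sum
`∑_{p ≠ 0} [√(p⁴ + 16πρa p²) - p² - 8πρa + (8πρa)²/(2p²)]` over any finite set of torus momenta is at
most the Lee–Huang–Yang energy `4πρ²a·(128/(15√π))√(ρa³)·L³` plus `O(L³ (ρa)^{5/2} (ρa L²)^{-1/4})`
(`lhy_correction_integral`). [cite: BastiCenatiempoSchlein2021, §3, (3.20)–(3.21)] -/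
theorem half_latticeSum_bogoliubov_le_lhy {ρ a L : ℝ} (hρ : 0 < ρ) (ha : 0 < a) (hL : 0 < L)
    {S : Finset (Fin 3 → ℤ)} (h0 : (0 : Fin 3 → ℤ) ∉ S) :
    1 / 2 * ∑ n ∈ S, (Real.sqrt (‖latticeVec (2 * Real.pi / L) n‖ ^ 4 +
          16 * Real.pi * ρ * a * ‖latticeVec (2 * Real.pi / L) n‖ ^ 2) -
        ‖latticeVec (2 * Real.pi / L) n‖ ^ 2 - 8 * Real.pi * ρ * a +
        (8 * Real.pi * ρ * a) ^ 2 / (2 * ‖latticeVec (2 * Real.pi / L) n‖ ^ 2)) ≤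
      L ^ 3 * (4 * Real.pi * ρ ^ 2 * a * lhyConstant * Real.sqrt (ρ * a ^ 3) +
        1 / 2 * ((2 * Real.pi) ^ 3)⁻¹ * (300000 * (8 * Real.pi * ρ * a) ^ 2 * Real.sqrt (8 * Real.pi * ρ * a) *
          (Real.sqrt ((2 * Real.pi / L) / Real.sqrt (8 * Real.pi * ρ * a)) +
            (2 * Real.pi / L) / Real.sqrt (8 * Real.pi * ρ * a)))) := by
  set μ := 8 * Real.pi * ρ * a with hμdef
  have hμ : 0 < μ := by positivity
  set h := 2 * Real.pi / L with hhdef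
  have hpi := Real.pi_pos
  have hh : 0 < h := by positivity
  have hmain := cube_mul_latticeSum_bogoliubov_le' hμ hh h0
  have h16 : 16 * Real.pi * ρ * a = 2 * μ := by rw [hμdef]; ring
  simp_rw [h16]
  have hscalar := lhy_scalar_identity hρ ha
  rw [← hμdef] at hscalar
  -- `h³ = (2π)³/L³`
  have hh3 : h ^ 3 = (2 * Real.pi) ^ 3 / L ^ 3 := by rw [hhdef, div_pow]
  have hL3 : 0 < L ^ 3 := by positivity
  have h2pi3 : 0 < (2 * Real.pi) ^ 3 := by positivity
  -- divide the main bound by `h³`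
  have hdiv : ∑ n ∈ S, (Real.sqrt (‖latticeVec h n‖ ^ 4 + 2 * μ * ‖latticeVec h n‖ ^ 2) -
      ‖latticeVec h n‖ ^ 2 - μ + μ ^ 2 / (2 * ‖latticeVec h n‖ ^ 2)) ≤
      L ^ 3 / (2 * Real.pi) ^ 3 * (32 * Real.sqrt 2 * Real.pi / 15 * μ ^ 2 * Real.sqrt μ +
        300000 * μ ^ 2 * Real.sqrt μ * (Real.sqrt (h / Real.sqrt μ) + h / Real.sqrt μ)) := by
    rw [hh3] at hmain
    rw [div_mul_eq_mul_div, le_div_iff₀ h2pi3]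
    calc (∑ n ∈ S, (Real.sqrt (‖latticeVec h n‖ ^ 4 + 2 * μ * ‖latticeVec h n‖ ^ 2) -
          ‖latticeVec h n‖ ^ 2 - μ + μ ^ 2 / (2 * ‖latticeVec h n‖ ^ 2))) * (2 * Real.pi) ^ 3
        = L ^ 3 * ((2 * Real.pi) ^ 3 / L ^ 3 * ∑ n ∈ S, (Real.sqrt (‖latticeVec h n‖ ^ 4 +
            2 * μ * ‖latticeVec h n‖ ^ 2) - ‖latticeVec h n‖ ^ 2 - μ + μ ^ 2 / (2 * ‖latticeVec h n‖ ^ 2))) := by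
          field_simp
      _ ≤ L ^ 3 * (32 * Real.sqrt 2 * Real.pi / 15 * μ ^ 2 * Real.sqrt μ +
            300000 * μ ^ 2 * Real.sqrt μ * (Real.sqrt (h / Real.sqrt μ) + h / Real.sqrt μ)) :=
          mul_le_mul_of_nonneg_left hmain hL3.le
  calc 1 / 2 * ∑ n ∈ S, (Real.sqrt (‖latticeVec h n‖ ^ 4 + 2 * μ * ‖latticeVec h n‖ ^ 2) -
        ‖latticeVec h n‖ ^ 2 - μ + μ ^ 2 / (2 * ‖latticeVec h n‖ ^ 2))
      ≤ 1 / 2 * (L ^ 3 / (2 * Real.pi) ^ 3 * (32 * Real.sqrt 2 * Real.pi / 15 * μ ^ 2 * Real.sqrt μ +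
          300000 * μ ^ 2 * Real.sqrt μ * (Real.sqrt (h / Real.sqrt μ) + h / Real.sqrt μ))) := by
        gcongr
    _ = L ^ 3 * (1 / 2 * ((2 * Real.pi) ^ 3)⁻¹ * (32 * Real.sqrt 2 * Real.pi / 15 * μ ^ 2 * Real.sqrt μ) +
          1 / 2 * ((2 * Real.pi) ^ 3)⁻¹ * (300000 * μ ^ 2 * Real.sqrt μ *
            (Real.sqrt (h / Real.sqrt μ) + h / Real.sqrt μ))) := by
        field_simp
    _ = L ^ 3 * (4 * Real.pi * ρ ^ 2 * a * lhyConstant * Real.sqrt (ρ * a ^ 3) +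
          1 / 2 * ((2 * Real.pi) ^ 3)⁻¹ * (300000 * μ ^ 2 * Real.sqrt μ *
            (Real.sqrt (h / Real.sqrt μ) + h / Real.sqrt μ))) := by
        rw [hscalar]

end Literature.MathematicalPhysics.QuantumManyBody.BoseGas

end
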